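import Summits.Ventures.DiscreteObjects.UnitDistance.FiniteFieldLowerBoundF19Data
import HarnessLib

/-!
# `UD(F₁₉²)` is not 4-colourable — kernel search, piece 4 of 12 (the subtree below `ud19Q4`)

Framing (verbatim for the cell): lottery ticket; floor = certified bounds/negative ranges.

The subtree of the colouring search (`KernelColouringSearch.lean`: bit-vector states, unit propagation, PASS branching) below the depth-3
state `ud19Q4` of `FiniteFieldLowerBoundF19Data.lean`, cut once more into 2 sub-states `ud19R4x1, ud19R4x2` (depth 4–5, each ≤ 0.7·10⁶
bit-vector operations so that one kernel evaluation stays within memory): each sub-state is refuted by `decide +kernel`, then `ud19Q4` is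
refuted by the search with those sub-states as its `done` list, and `ud19_piece4` packages the logical statement used by
`FiniteFieldLowerBoundF19.lean`: no proper 4-colouring is consistent with `ud19Q4`.
-/

namespace Summit.Ventures.DiscreteObjects.UnitDistance

open KBits

/-- Search state after the branches `1 ↦ 1 → 43 ↦ 2 → 42 ↦ 3 → 61 ↦ 0` (vertex ↦ colour, each followed by unit propagation). -/
def ud19R4x1 : ℕ × ℕ × ℕ × ℕ × ℕ :=
  (4696466435789095817572019550146641577393536547243525533868563075039779661339412950908190995976206862582478845,
   4403354888476495349634585599714636634589156965796954147984121884239018829147397040492797978921644986809188346,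
   3486117893980954802566497560384902695155242213276505738265807843465181596248715929809990716249885648805690876,
   4091601529764310629172729376981788374953303655546572739840194893264799823238966408368694356509711527434518268,
   4697085165547666455778961193578674054751365097816639741414581943064418050229216886927397994463681202710118396)

/-- Search state after the branches `1 ↦ 1 → 43 ↦ 2 → 42 ↦ 3 → 61 ↦ 2` (vertex ↦ colour, each followed by unit propagation). -/
def ud19R4x2 : ℕ × ℕ × ℕ × ℕ × ℕ :=
  (4697075646358968180325372677038615227172210596351363203000088351651265234388229435256121867150405594604896253,
   4403354888476495349634585599714636634589156965796954147984121884239018829147397040492797978921644986809188346,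
   3485508683411082439813144433492929045376568164168668069134282566853696023199899445462059849687372935210661372,
   4091601529764310629172729376981788374953303655546572739840194893264799823238966408368694356509711527434518268,
   4697085165547666455778961193578674054751365097816639741414581943064418050229216886927397994463681202710118396)

set_option maxHeartbeats 400000000 in
set_option maxRecDepth 200000 in
/-- KERNEL FACT: the search refutes every 4-colouring below `ud19R4x1`. -/
theorem ud19R4x1_run : search ud19nb 361 40 [] 361 ud19R4x1 = true := by
  decide +kernel

set_option maxHeartbeats 400000000 in
set_option maxRecDepth 200000 in
/-- KERNEL FACT: the search refutes every 4-colouring below `ud19R4x2`. -/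
theorem ud19R4x2_run : search ud19nb 361 40 [] 361 ud19R4x2 = true := by
  decide +kernel

set_option maxHeartbeats 400000000 in
set_option maxRecDepth 200000 in
/-- KERNEL FACT: below `ud19Q4` every branch dies or reaches one of the refuted sub-states. -/
theorem ud19Q4_run : search ud19nb 361 40 [ud19R4x1, ud19R4x2] 361 ud19Q4 = true := by
  decide +kernel

/-- PIECE 4: no proper 4-colouring (for the neighbourhood words `ud19nb`) is consistent with the state `ud19Q4`. -/
theorem ud19_piece4 {col : ℕ → ℕ} (hP : Proper ud19nb 361 col) :
    UBound 361 ud19Q4 → Cons 361 col ud19Q4 → False := by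
  refine search_sound hP (done := [ud19R4x1, ud19R4x2]) ?_ 361 _ ud19Q4_run
  intro d hd
  simp only [List.mem_cons, List.not_mem_nil, or_false] at hd
  rcases hd with rfl | rfl
  · exact search_sound hP (done := []) (by simp) 361 _ ud19R4x1_run
  · exact search_sound hP (done := []) (by simp) 361 _ ud19R4x2_run

end Summit.Ventures.DiscreteObjects.UnitDistance
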